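import Literature.IUT.LogVolume.TensorPacketFactorDifferent
import HarnessLib

/-!
# The LEAST factor-field different of a tensor packet: `min_J d_{L_J} ≤ d_{k'}` for every field `k'` generated by images
# of the slots — equal slots (no normality), and slots of several types ([IUTchIV] Prop. 1.1; Dupuy–Hilado §4.12)

abc-iut cell, seat abc-iut-w6-d018 (sequel to `TensorPacketFactorDifferent`, R2 TARGET #1 «Rest_lower»). The sharp lower
end of the (Ind2)-orbit-hull volume (`TensorPacketContentSharp.packetLogμ_packetHull_orbit_ge_sharp_inf`) gains
`d_I − min_J d_{L_J}` per collection, `d_{L_J}` the different exponent of the factor field `L_J` of `V = ⊗_{ℚ_p} k_i ≅ ∏_J L_J`.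
`TensorPacketFactorDifferent` evaluated EVERY `d_{L_J}` for packets of one NORMAL field. For the MINIMUM no normality is
needed, and slots of several types are allowed:

* **`exists_dFac_algEquiv_of_adjoin_eq_top`** — if `φ_i : k_i → k'` are `ℚ_p`-algebra maps into a field `k'` whose images
  generate `k'`, then `k'` IS a factor: `L_J ≃ₐ[ℚ_p] k'` for some `J` (the multiplication map `⊗x_i ↦ ∏φ_i(x_i)` is an
  algebra surjection `V → k'` onto a field; on `∏_J L_J` it is supported on one idempotent);
* `inf_differentOrd_dFac_le_of_adjoin_eq_top` — hence **`min_J d_{L_J} ≤ d_{k'}`** (algebra isomorphisms of these fields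
  are isometries);
* **`inf_differentOrd_dFac_eq_of_algEquiv`** — EQUAL SLOTS `k_i ≅ k_{i₀}` (any field, normal or not): `min_J d_{L_J} = d_{i₀}`
  (`≤` with `k' = k_{i₀}`; `≥` by `differentOrd_le_differentOrd_dFac`), so the sharp different gain is EXACTLY
  `(|I| − 1)·d_{i₀} = d_{I*}` (`dSum_sub_inf_differentOrd_dFac_eq_of_algEquiv`) — [IUTchIV] Prop. 1.1's exponent is
  attained by the lower end of the volume for every equal-slot packet;
* **`inf_differentOrd_dFac_le_of_types`** — SLOTS OF SEVERAL TYPES: if each `k_i` is isomorphic to `k'_{c(i)}` for a type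
  map `c : I → S` onto `S`, then `min_J d_{L_J}(k) ≤ min_{J'} d_{L'_{J'}}(k')` for the packet `k'` of the DISTINCT types —
  the loss in the sharp gain does not grow with the number of slots, only with the number of distinct fields (for the
  capsules of [IUTchIII] Cor. 3.12 at a prime `p`: the distinct completions `K_{v̲}`, `v ∈ V(F_mod)_p`, occurring in `v⃗`).
Classical commutative algebra; the tags record the cell's typing of [IUTchIV] §1. [cite: Mochizuki2012, IUTchIV Prop. 1.1
p. 9, Prop. 1.4 (i) p. 13] No side taken on [IUTchIII] Cor. 3.12 [claim: Mochizuki2012, status: disputed]. PROOF-ONLY file: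
no definitions, no instances, no named `Prop` facts.
-/

noncomputable section

open Set Module Function
open scoped TensorProduct NormedField

namespace Literature.IUT.LogVolume

section Generated

variable (p : ℕ) [Fact p.Prime]
variable {I : Type} [Fintype I] [DecidableEq I]
variable (k : I → Type) [∀ i, NontriviallyNormedField (k i)] [∀ i, NormedAlgebra ℚ_[p] (k i)]
  [∀ i, IsUltrametricDist (k i)] [∀ i, ProperSpace (k i)]
variable {k' : Type} [NontriviallyNormedField k'] [NormedAlgebra ℚ_[p] k'] [IsUltrametricDist k'] [ProperSpace k']

omit [DecidableEq I] [∀ i, IsUltrametricDist (k i)] [∀ i, ProperSpace (k i)] [IsUltrametricDist k']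
  [ProperSpace k'] in
/-- **The multiplication map `⊗x_i ↦ ∏_i φ_i(x_i)`** for `ℚ_p`-algebra maps `φ_i : k_i → k'`: an algebra homomorphism
`V → k'` with `ι_i(a) ↦ φ_i(a)`. [cite: Mochizuki2012, IUTchIV Prop. 1.4 (i) p. 13] -/
theorem exists_algHom_purePacket (φ : ∀ i, k i →ₐ[ℚ_[p]] k') :
    ∃ m : PacketAlgebra p k →ₐ[ℚ_[p]] k', ∀ x : Π i, k i, m (purePacket p k x) = ∏ i, φ i (x i) := by
  let f : MultilinearMap ℚ_[p] k k' :=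
    (MultilinearMap.mkPiAlgebra ℚ_[p] I k').compLinearMap fun i => (φ i).toLinearMap
  have hf : ∀ x : Π i, k i, f x = ∏ i, φ i (x i) := fun x => by
    simp only [f, MultilinearMap.compLinearMap_apply, AlgHom.toLinearMap_apply, MultilinearMap.mkPiAlgebra_apply]
  refine ⟨PiTensorProduct.liftAlgHom f ?_ ?_, fun x => ?_⟩
  · rw [hf]; simp
  · intro x y; rw [hf, hf, hf, ← Finset.prod_mul_distrib]
    exact Finset.prod_congr rfl fun i _ => by rw [Pi.mul_apply, map_mul]
  · rw [PiTensorProduct.liftAlgHom_apply, purePacket, PiTensorProduct.lift.tprod, hf]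

omit [∀ i, IsUltrametricDist (k i)] [IsUltrametricDist k'] [ProperSpace k'] in
/-- **A field generated by images of the slots IS a factor of the packet.** If `φ_i : k_i → k'` are `ℚ_p`-algebra maps
whose images generate the field `k'`, then `L_J ≃ₐ[ℚ_p] k'` for some factor `J` of the chosen decomposition
`V ≅ ∏_J L_J` (the multiplication map is onto the field `k'`; through `ψ⁻¹` it sends the idempotents `e_J` to `0` or `1`,
exactly one to `1`, and restricts to an isomorphism on that factor). [cite: Mochizuki2012, IUTchIV Prop. 1.4 (i) p. 13] -/
theorem exists_dFac_algEquiv_of_adjoin_eq_top (φ : ∀ i, k i →ₐ[ℚ_[p]] k')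
    (hgen : Algebra.adjoin ℚ_[p] (⋃ i, Set.range (φ i)) = ⊤) :
    ∃ J : DIdx p k, Nonempty (DFac p k J ≃ₐ[ℚ_[p]] k') := by
  classical
  obtain ⟨m, hm⟩ := exists_algHom_purePacket p k φ
  -- `m` is onto
  have hmsurj : Function.Surjective m := by
    have hrange : m.range = ⊤ := by
      rw [eq_top_iff, ← hgen, Algebra.adjoin_le_iff]
      rintro _ ⟨_, ⟨i, rfl⟩, ⟨a, rfl⟩⟩
      refine ⟨iota p k i a, ?_⟩
      show m (iota p k i a) = φ i a
      have h := hm (Pi.mulSingle i a)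
      have hι : purePacket p k (Pi.mulSingle i a) = iota p k i a := rfl
      rw [hι] at h
      rw [h, ← Finset.mul_prod_erase _ _ (Finset.mem_univ i), Pi.mulSingle_eq_same,
        Finset.prod_eq_one (fun j hj => by rw [Pi.mulSingle_eq_of_ne (Finset.ne_of_mem_erase hj), map_one]), mul_one]
    intro y
    have hy : y ∈ m.range := by rw [hrange]; exact Algebra.mem_top
    exact hy
  -- transport to `∏_J L_J`
  let g : (Π J : DIdx p k, DFac p k J) →ₐ[ℚ_[p]] k' := m.comp ((dEquiv p k).symm : (Π J, DFac p k J) →ₐ[ℚ_[p]] _)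
  have hgsurj : Function.Surjective g := fun y => by
    obtain ⟨x, rfl⟩ := hmsurj y
    exact ⟨dEquiv p k x, by simp [g]⟩
  -- the idempotents go to `0` or `1`, and not all to `0`
  have hidem : ∀ J, g (Pi.single J 1) = 0 ∨ g (Pi.single J 1) = 1 := fun J => by
    have h : IsIdempotentElem (g (Pi.single J 1)) := by
      rw [IsIdempotentElem, ← map_mul, ← Pi.single_mul, mul_one]
    exact IsIdempotentElem.iff_eq_zero_or_one.mp h
  have hsum : ∑ J, g (Pi.single J (1 : DFac p k J)) = 1 := by
    have h1 := Finset.univ_sum_single (1 : Π J : DIdx p k, DFac p k J)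
    simp only [Pi.one_apply] at h1
    rw [← map_sum, h1, map_one]
  obtain ⟨J₀, hJ₀⟩ : ∃ J, g (Pi.single J 1) = 1 := by
    by_contra h
    push Not at h
    have : ∑ J, g (Pi.single J (1 : DFac p k J)) = 0 :=
      Finset.sum_eq_zero fun J _ => (hidem J).resolve_right (h J)
    rw [hsum] at this
    exact one_ne_zero this
  have hzero : ∀ J, J ≠ J₀ → g (Pi.single J 1) = 0 := fun J hJ => by
    have h := congrArg g (show Pi.single J (1 : DFac p k J) * Pi.single J₀ 1 = 0 by
      ext J'
      rw [Pi.mul_apply, Pi.zero_apply]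
      by_cases h1 : J' = J
      · subst h1; rw [Pi.single_eq_of_ne hJ, mul_zero]
      · rw [Pi.single_eq_of_ne h1, zero_mul])
    rwa [map_mul, hJ₀, mul_one, map_zero] at h
  -- the restriction to the factor `J₀`
  let h : DFac p k J₀ →ₐ[ℚ_[p]] k' :=
    { toFun := fun x => g (Pi.single J₀ x)
      map_one' := hJ₀
      map_mul' := fun x y => by rw [← map_mul, ← Pi.single_mul]
      map_zero' := by rw [Pi.single_zero, map_zero]
      map_add' := fun x y => by rw [← map_add, ← Pi.single_add]
      commutes' := fun c => by
        rw [Algebra.algebraMap_eq_smul_one, Pi.single_smul, map_smul, hJ₀, Algebra.smul_def, mul_one] }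
  have hh : Function.Bijective h := by
    refine ⟨h.toRingHom.injective, fun y => ?_⟩
    obtain ⟨z, rfl⟩ := hgsurj y
    refine ⟨z J₀, ?_⟩
    show g (Pi.single J₀ (z J₀)) = g z
    conv_rhs => rw [← Finset.univ_sum_single z, map_sum]
    rw [Fintype.sum_eq_single J₀ fun J hJ => ?_]
    have hz : Pi.single J (z J) = Pi.single J (z J) * Pi.single J (1 : DFac p k J) := by
      rw [← Pi.single_mul, mul_one]
    rw [hz, map_mul, hzero J hJ, mul_zero]
  exact ⟨J₀, ⟨AlgEquiv.ofBijective h hh⟩⟩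

omit [∀ i, IsUltrametricDist (k i)] in
/-- **`min_J d_{L_J} ≤ d_{k'}`** for every field `k'` generated by images of the slots (`k'` is a factor, and `ℚ_p`-algebra
isomorphisms of these fields are isometries). [cite: Mochizuki2012, IUTchIV Prop. 1.1 p. 9] -/
theorem inf_differentOrd_dFac_le_of_adjoin_eq_top (φ : ∀ i, k i →ₐ[ℚ_[p]] k')
    (hgen : Algebra.adjoin ℚ_[p] (⋃ i, Set.range (φ i)) = ⊤) :
    (Finset.univ : Finset (DIdx p k)).inf' Finset.univ_nonempty (fun J => differentOrd p (DFac p k J)) ≤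
      differentOrd p k' := by
  obtain ⟨J, ⟨e⟩⟩ := exists_dFac_algEquiv_of_adjoin_eq_top p k φ hgen
  refine (Finset.inf'_le _ (Finset.mem_univ J)).trans_eq ?_
  exact differentOrd_eq_of_isometry_of_surjective p (e : DFac p k J →ₐ[ℚ_[p]] k')
    (fun x => norm_map_algHom (e : DFac p k J →ₐ[ℚ_[p]] k') x) e.surjective

end Generated

/-! ## Equal slots (no normality) and slots of several types -/

section Types

variable (p : ℕ) [Fact p.Prime]
variable {I : Type} [Fintype I] [DecidableEq I]
variable (k : I → Type) [∀ i, NontriviallyNormedField (k i)] [∀ i, NormedAlgebra ℚ_[p] (k i)]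
  [∀ i, IsUltrametricDist (k i)] [∀ i, ProperSpace (k i)]

/-- **EQUAL SLOTS: `min_J d_{L_J} = d_{i₀}`** for every packet whose slots are all `ℚ_p`-isomorphic to `k_{i₀}` — normal or not
(`≤`: `k_{i₀}` itself is generated by the images `τ_i⁻¹(k_i)`; `≥`: `differentOrd_le_differentOrd_dFac`).
[cite: Mochizuki2012, IUTchIV Prop. 1.1 p. 9] -/
theorem inf_differentOrd_dFac_eq_of_algEquiv (i₀ : I) (τ : ∀ i, k i₀ ≃ₐ[ℚ_[p]] k i) :
    (Finset.univ : Finset (DIdx p k)).inf' Finset.univ_nonempty (fun J => differentOrd p (DFac p k J)) =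
      differentOrd p (k i₀) := by
  refine le_antisymm ?_ ?_
  · refine inf_differentOrd_dFac_le_of_adjoin_eq_top p k (fun i => ((τ i).symm : k i →ₐ[ℚ_[p]] k i₀)) ?_
    rw [eq_top_iff]
    intro x _
    exact Algebra.subset_adjoin (Set.mem_iUnion.mpr ⟨i₀, ⟨τ i₀ x, (τ i₀).symm_apply_apply x⟩⟩)
  · exact Finset.le_inf' _ _ fun J _ => differentOrd_le_differentOrd_dFac p k i₀ J

/-- **EQUAL SLOTS: the sharp different gain is EXACTLY `(|I| − 1)·d_{i₀}`** (`= d_{I*}` of [IUTchIV] Prop. 1.1), for every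
field, normal or not — the term of `TensorPacketContentSharp.packetLogμ_packetHull_orbit_ge_sharp_inf` evaluated.
[cite: Mochizuki2012, IUTchIV Prop. 1.1 p. 9] -/
theorem dSum_sub_inf_differentOrd_dFac_eq_of_algEquiv (i₀ : I) (τ : ∀ i, k i₀ ≃ₐ[ℚ_[p]] k i) :
    dSum p k - (Finset.univ : Finset (DIdx p k)).inf' Finset.univ_nonempty (fun J => differentOrd p (DFac p k J)) =
      ((Fintype.card I : ℝ) - 1) * differentOrd p (k i₀) := by
  have hsum : dSum p k = (Fintype.card I : ℝ) * differentOrd p (k i₀) := by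
    rw [dSum, Finset.sum_congr rfl (fun i _ => differentOrd_eq_of_algEquiv_isometry p k (τ i)),
      Finset.sum_const, Finset.card_univ, nsmul_eq_mul]
  rw [inf_differentOrd_dFac_eq_of_algEquiv p k i₀ τ, hsum]
  ring

variable {S : Type} [Fintype S] [DecidableEq S]
variable (k' : S → Type) [∀ s, NontriviallyNormedField (k' s)] [∀ s, NormedAlgebra ℚ_[p] (k' s)]
  [∀ s, IsUltrametricDist (k' s)] [∀ s, ProperSpace (k' s)]

omit [∀ i, IsUltrametricDist (k i)] [∀ s, IsUltrametricDist (k' s)] in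
/-- **SLOTS OF SEVERAL TYPES: `min_J d_{L_J}(k) ≤ min_{J'} d_{L'_{J'}}(k')`** for the packet `k'` of the distinct types, when
each slot `k_i` is `ℚ_p`-isomorphic to its type `k'_{c(i)}` and every type occurs (`c` onto): each factor `L'_{J'}` of
`⊗_s k'_s` is generated by the images of the types (`mem_of_forall_range_factorEmb_subset`), hence by images of the slots,
hence is a factor of `⊗_i k_i`. So the loss `min_J d_{L_J}` in the sharp gain is bounded by the distinct fields only,
uniformly in the number of slots. [cite: Mochizuki2012, IUTchIV Prop. 1.1 p. 9, Prop. 1.4 (i) p. 13] -/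
theorem inf_differentOrd_dFac_le_of_types (c : I → S) (hc : Function.Surjective c) (τ : ∀ i, k' (c i) ≃ₐ[ℚ_[p]] k i) :
    (Finset.univ : Finset (DIdx p k)).inf' Finset.univ_nonempty (fun J => differentOrd p (DFac p k J)) ≤
      (Finset.univ : Finset (DIdx p k')).inf' Finset.univ_nonempty (fun J' => differentOrd p (DFac p k' J')) := by
  obtain ⟨J', -, hJ'⟩ := Finset.exists_mem_eq_inf' (Finset.univ_nonempty : (Finset.univ :
    Finset (DIdx p k')).Nonempty) (fun J' => differentOrd p (DFac p k' J'))
  rw [hJ']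
  -- slot `i` maps to the factor `L'_{J'}` through its type
  let φ : ∀ i, k i →ₐ[ℚ_[p]] DFac p k' J' :=
    fun i => (factorEmb p k' (DFac p k') (dEquiv p k') (c i) J').comp ((τ i).symm : k i →ₐ[ℚ_[p]] k' (c i))
  refine inf_differentOrd_dFac_le_of_adjoin_eq_top p k φ ?_
  rw [eq_top_iff]
  intro x _
  -- the intermediate field generated by the slot images contains every type image, hence is everything
  let E : IntermediateField ℚ_[p] (DFac p k' J') := IntermediateField.adjoin ℚ_[p] (⋃ i, Set.range (φ i))
  have hE : ∀ s, Set.range (factorEmb p k' (DFac p k') (dEquiv p k') s J') ⊆ (E : Set (DFac p k' J')) := by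
    intro s
    obtain ⟨i, rfl⟩ := hc s
    rintro _ ⟨y, rfl⟩
    refine IntermediateField.subset_adjoin _ _ (Set.mem_iUnion.mpr ⟨i, ⟨τ i y, ?_⟩⟩)
    show factorEmb p k' (DFac p k') (dEquiv p k') (c i) J' ((τ i).symm (τ i y)) = _
    rw [AlgEquiv.symm_apply_apply]
  have hx : x ∈ E := mem_of_forall_range_factorEmb_subset p k' J' E hE x
  -- a finite-dimensional intermediate field generated by a set is the algebra adjoin of that set
  have hfin : ∀ y ∈ (⋃ i, Set.range (φ i)), IsAlgebraic ℚ_[p] y := fun y _ =>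
    Algebra.IsAlgebraic.isAlgebraic (R := ℚ_[p]) y
  rw [← IntermediateField.adjoin_toSubalgebra_of_isAlgebraic hfin]
  exact hx

end Types

end Literature.IUT.LogVolume

end
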